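import Mathlib.Algebra.MvPolynomial.Funext
import Mathlib.Algebra.Polynomial.Roots
import Literature.ModelTheory.Zilber.EACPeriodicReduction
import Literature.ModelTheory.Zilber.EACDensityProofs
import HarnessLib

/-!
# EAC cell `(3, 2)`, periodic sub-cell: side cylinders meet the graph of `exp` (the swap trick)

Zilber's Exponential-Algebraic Closedness, case ladder, host summit Schanuel (cell pub-schanuel).
After `EACPeriodicReduction` the open cell `ECCell 3 2` is the conjunction of three typed OPEN
pieces, `ECCellAperiodic 2 ∧ ECCellPeriodicStdFib 2 ∧ ECCellPeriodicStdDom 2`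
(`ecCell_three_two_iff_three`): in the two periodic pieces the closure of the additive projection
`cl π(V) ⊆ ℂ³` is a cylinder `C × ℂ` over the LAST coordinate (period vector `e_last`).

This file SETTLES a sub-case of both periodic pieces and refines the split accordingly.

* `IsCoordCylinder W j` — `W` is a cylinder in the coordinate `j` (membership does not depend on
  the `j`-th coordinate).  A *side cylinder* of the periodic cell is a `W` that is a cylinder in a
  MULTIPLICATIVE coordinate `yᵢ` with `i ≠ last` (a coordinate over the curve factor `C`).
* **The swap trick** (`xySwap`, `swapSet`, `inter_expGraph_nonempty_of_cylinder_of_swap`): if `W`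
  is a cylinder in `yᵢ`, exchange the roles of `xᵢ` and `yᵢ` — the coordinate permutation
  `σᵢ = (inl i  inr i)` of `ℂⁿ × ℂⁿ` carries `W` to a Zariski closed `W♯ = {z | z ∘ σᵢ ∈ W}` whose
  additive coordinates are `(x_j)_{j ≠ i}` together with the FREE coordinate `yᵢ`; an exponential
  point of `W♯` (Aslanyan–Kirby–Mantova 2023 Thm. 1.5 = Brownawell–Masser 2017 Prop. 2, the tree
  THEOREM `aslanyanKirbyMantova2023_thm_1_5_holds`: closed + dominant additive projection suffice)
  pulls back to a point of `W` all of whose coordinates but `yᵢ` are exponential, and the cylinder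
  lets us reset `yᵢ := exp xᵢ`.  This is the same move as Mantova–Masser's "simple trick"
  (PLMS 2024 = arXiv:2303.05592, p. 5; tree `liftEqns`): a multiplicative slot may hold any
  algebraic quantity as long as its additive partner is free.
* **Dominance of the swap** (`hasDominantAddProjection_swapSet_of_cylinder`): for irreducible `W`
  meeting the torus with additively free torus part, `W♯ ∩ Gⁿ` projects dominantly as soon as
  `π(V) + ℂ·eᵢ` is Zariski dense in `ℂⁿ` (`HasDominantAddProjectionOff i V`), and in the normalised
  periodic sub-cell of `EC(3,2)` the latter is automatic for `i ≠ last`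
  (`hasDominantAddProjectionOff_of_update_invariant`: the closure of `π(V)` is a cylinder over the
  last coordinate and the remaining coordinate takes infinitely many values by additive freeness).
* **Theorem** (`inter_expGraph_nonempty_of_isPeriodVec_of_cylinder`): an irreducible closed
  `W ⊆ ℂ³ × ℂ³` meeting `G³`, with additively free torus part, whose base has the period `e_last`
  and which is a cylinder in some `yᵢ`, `i ≠ last`, meets the graph of `exp` — NO rotundity,
  multiplicative freeness or dimension hypotheses are needed.
* **Refined split** (`ecCell_three_two_iff_three_nc`):
  `ECCell 3 2 ↔ ECCellAperiodic 2 ∧ ECCellPeriodicStdFibNC 2 ∧ ECCellPeriodicStdDomNC 2`, the two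
  periodic pieces now carrying the extra binder "`W` is a cylinder in NO `yᵢ`, `i ≠ last`".  Both
  `NC` pieces remain OPEN and are never asserted.

Honest framing: a modest structural sub-case of one open cell of Zilber's EAC conjecture, settled
by a coordinate swap on top of a published theorem (Brownawell–Masser / Aslanyan–Kirby–Mantova);
`ECCell 3 2` itself stays OPEN; nothing here bears on Schanuel's conjecture, and EAC does not imply
SC.

## References

* V. Aslanyan, J. Kirby, V. Mantova, *A geometric approach to some systems of exponential
  equations*, IMRN 2023, Thm. 1.5.
* W. D. Brownawell, D. W. Masser, *Zero estimates with moving targets*, JLMS 95 (2017), Prop. 2.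
* V. Mantova, D. Masser, *Polynomial-exponential equations — some new cases of solvability*,
  PLMS 129 (2024) e12627 = arXiv:2303.05592, §1 (p. 5, "a simple trick shows …").
-/

noncomputable section

open MvPolynomial

namespace Literature.ModelTheory.Zilber

open Literature.NumberTheory.Transcendental
open Literature.ModelTheory.ExponentialFields

variable {K : Type*} [Field K] {n : ℕ}

/-! ## Coordinate cylinders -/

/-- `W ⊆ K^ι` is a **cylinder in the coordinate `j`**: membership in `W` does not depend on the
`j`-th coordinate (`z ∈ W ⇒ update z j t ∈ W` for all `t`). [folklore] -/
def IsCoordCylinder {K : Type*} {ι : Type*} [DecidableEq ι] (W : Set (ι → K)) (j : ι) : Prop :=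
  ∀ z ∈ W, ∀ t : K, Function.update z j t ∈ W

/-- Substituting the constant `t` for the variable `X i` and evaluating = evaluating at the updated
point. [folklore] -/
theorem eval_bind₁_update_X_C {ι : Type*} [DecidableEq ι] (i : ι) (t : K) (p : MvPolynomial ι K)
    (y : ι → K) :
    eval y (bind₁ (Function.update X i (C t)) p) = eval (Function.update y i t) p := by
  have h1 : (fun j => aeval y (Function.update (X : ι → MvPolynomial ι K) i (C t) j)) =
      Function.update y i t := by
    funext j
    by_cases hj : j = i
    · subst hj; simp
    · simp [Function.update_of_ne hj]
  have := aeval_bind₁ y (Function.update X i (C t)) p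
  rw [h1] at this
  exact this

/-! ## Additive freeness: no additive coordinate is constant -/

/-- If `V` is additively free then no additive coordinate is constant on `V`:
`Xᵢ - c ∉ I(V)`. [folklore] -/
theorem X_inl_sub_C_notMem_vanishingIdeal_of_isAddFree {V : Set (Fin n ⊕ Fin n → K)}
    (hV : IsAddFree K n V) (i : Fin n) (c : K) :
    (X (Sum.inl i) - C c : MvPolynomial (Fin n ⊕ Fin n) K) ∉ vanishingIdeal K V := by
  intro h
  refine hV (Pi.single i 1) ?_ ⟨c, fun z hz => ?_⟩
  · intro h0
    have := congr_fun h0 i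
    simp at this
  · have hz' := (mem_vanishingIdeal_iff.1 h) z hz
    rw [map_sub, aeval_X, aeval_C, sub_eq_zero] at hz'
    rw [Finset.sum_eq_single i]
    · simpa using hz'
    · intro j _ hj
      simp [Pi.single_eq_of_ne hj]
    · intro hi
      exact absurd (Finset.mem_univ i) hi

/-- If `V` is additively free then `Xᵢ ∉ I(V)`. [folklore] -/
theorem X_inl_notMem_vanishingIdeal_of_isAddFree {V : Set (Fin n ⊕ Fin n → K)}
    (hV : IsAddFree K n V) (i : Fin n) :
    (X (Sum.inl i) : MvPolynomial (Fin n ⊕ Fin n) K) ∉ vanishingIdeal K V := by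
  have := X_inl_sub_C_notMem_vanishingIdeal_of_isAddFree hV i 0
  rwa [C_0, sub_zero] at this

/-- If `W` is irreducible, meets the torus, and `W ∩ Gⁿ` is additively free, then every additive
coordinate takes infinitely many values on `W ∩ Gⁿ` (finitely many values `c₁, …, c_m` would put
`∏ (Xᵢ - c_k)` in the prime `I(W ∩ Gⁿ)`). [folklore] -/
theorem infinite_inl_image_of_isAddFree {W : Set (Fin n ⊕ Fin n → K)} (hW : IsIrreducibleClosed K W)
    (hne : (W ∩ torusLocus K n).Nonempty) (hadd : IsAddFree K n (W ∩ torusLocus K n)) (i : Fin n) :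
    ((fun z => z (Sum.inl i)) '' (W ∩ torusLocus K n)).Infinite := by
  intro hfin
  set s := hfin.toFinset with hs
  haveI hprime := vanishingIdeal_inter_torusLocus_isPrime_of_irred hW hne
  have hmem : (∏ c ∈ s, (X (Sum.inl i) - C c) : MvPolynomial (Fin n ⊕ Fin n) K) ∈
      vanishingIdeal K (W ∩ torusLocus K n) := by
    rw [mem_vanishingIdeal_iff]
    intro z hz
    rw [map_prod]
    refine Finset.prod_eq_zero (i := z (Sum.inl i)) ?_ ?_
    · rw [hs, Set.Finite.mem_toFinset]
      exact ⟨z, hz, rfl⟩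
    · simp
  obtain ⟨c, -, hc⟩ := Ideal.IsPrime.prod_mem_iff.mp hmem
  exact X_inl_sub_C_notMem_vanishingIdeal_of_isAddFree hadd i c hc

/-! ## The swap `xᵢ ↔ yᵢ` -/

/-- The coordinate permutation `σᵢ` of `Kⁿ × Kⁿ` exchanging the additive coordinate `xᵢ` with the
multiplicative coordinate `yᵢ` (all other coordinates fixed). [folklore] -/
def xySwap (i : Fin n) : Equiv.Perm (Fin n ⊕ Fin n) :=
  Equiv.swap (Sum.inl i) (Sum.inr i)

/-- `σᵢ (inl i) = inr i`. [folklore] -/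
@[simp] theorem xySwap_inl_self (i : Fin n) : xySwap i (Sum.inl i) = Sum.inr i :=
  Equiv.swap_apply_left _ _

/-- `σᵢ (inr i) = inl i`. [folklore] -/
@[simp] theorem xySwap_inr_self (i : Fin n) : xySwap i (Sum.inr i) = Sum.inl i :=
  Equiv.swap_apply_right _ _

/-- `σᵢ` fixes `inl j` for `j ≠ i`. [folklore] -/
theorem xySwap_inl_of_ne {i j : Fin n} (h : j ≠ i) : xySwap i (Sum.inl j) = Sum.inl j :=
  Equiv.swap_apply_of_ne_of_ne (by simpa using h) (by simp)

/-- `σᵢ` fixes `inr j` for `j ≠ i`. [folklore] -/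
theorem xySwap_inr_of_ne {i j : Fin n} (h : j ≠ i) : xySwap i (Sum.inr j) = Sum.inr j :=
  Equiv.swap_apply_of_ne_of_ne (by simp) (by simpa using h)

/-- `σᵢ` on additive slots. [folklore] -/
theorem xySwap_inl (i j : Fin n) :
    xySwap i (Sum.inl j) = if j = i then Sum.inr i else Sum.inl j := by
  by_cases h : j = i
  · subst h; simp
  · rw [if_neg h, xySwap_inl_of_ne h]

/-- `σᵢ` on multiplicative slots. [folklore] -/
theorem xySwap_inr (i j : Fin n) :
    xySwap i (Sum.inr j) = if j = i then Sum.inl i else Sum.inr j := by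
  by_cases h : j = i
  · subst h; simp
  · rw [if_neg h, xySwap_inr_of_ne h]

/-- `σᵢ` is an involution. [folklore] -/
@[simp] theorem xySwap_xySwap (i : Fin n) (j : Fin n ⊕ Fin n) : xySwap i (xySwap i j) = j :=
  Equiv.swap_apply_self _ _ _

omit [Field K] in
/-- `(z ∘ σᵢ) ∘ σᵢ = z`. [folklore] -/
@[simp] theorem comp_xySwap_comp_xySwap (i : Fin n) (z : Fin n ⊕ Fin n → K) :
    (z ∘ xySwap i) ∘ xySwap i = z := by
  funext j
  simp

/-- **The swapped set** `W♯ = {z | z ∘ σᵢ ∈ W}`: `W` with the roles of `xᵢ` and `yᵢ` exchanged.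
[folklore] -/
def swapSet (i : Fin n) (W : Set (Fin n ⊕ Fin n → K)) : Set (Fin n ⊕ Fin n → K) :=
  {z | z ∘ xySwap i ∈ W}

omit [Field K] in
/-- Membership in `W♯`. [folklore] -/
theorem mem_swapSet_iff (i : Fin n) (W : Set (Fin n ⊕ Fin n → K)) (z : Fin n ⊕ Fin n → K) :
    z ∈ swapSet i W ↔ z ∘ xySwap i ∈ W :=
  Iff.rfl

omit [Field K] in
/-- `w ∘ σᵢ ∈ W♯ ↔ w ∈ W`. [folklore] -/
theorem comp_xySwap_mem_swapSet_iff (i : Fin n) (W : Set (Fin n ⊕ Fin n → K))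
    (w : Fin n ⊕ Fin n → K) : w ∘ xySwap i ∈ swapSet i W ↔ w ∈ W := by
  rw [mem_swapSet_iff, comp_xySwap_comp_xySwap]

/-- Pulling a zero locus back along a map of coordinates gives a zero locus:
`{z | z ∘ g ∈ Z(I)} = Z(⟨rename g (I)⟩)`. [folklore] -/
theorem setOf_comp_mem_zeroLocus {ι κ : Type*} (g : ι → κ) (I : Ideal (MvPolynomial ι K)) :
    {z : κ → K | z ∘ g ∈ zeroLocus K I} = zeroLocus K (I.map (rename g)) := by
  ext z
  rw [Ideal.map, zeroLocus_span]
  simp only [Set.mem_setOf_eq, mem_zeroLocus_iff, Set.forall_mem_image, aeval_rename,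
    SetLike.mem_coe]

/-- The pull-back of a Zariski closed set along a map of coordinates is Zariski closed. [folklore] -/
theorem isZariskiClosed_setOf_comp_mem {ι κ : Type*} (g : ι → κ) {W : Set (ι → K)}
    (hW : IsZariskiClosed K W) : IsZariskiClosed K {z : κ → K | z ∘ g ∈ W} := by
  obtain ⟨I, rfl⟩ := hW
  exact ⟨_, setOf_comp_mem_zeroLocus g I⟩

/-- `W♯` is Zariski closed if `W` is. [folklore] -/
theorem isZariskiClosed_swapSet (i : Fin n) {W : Set (Fin n ⊕ Fin n → K)}
    (hW : IsZariskiClosed K W) : IsZariskiClosed K (swapSet i W) :=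
  isZariskiClosed_setOf_comp_mem (xySwap i) hW

/-! ## The swap trick: cylinders in `yᵢ` meet the graph of `exp` -/

/-- **The swap trick.** Let `W ⊆ ℂⁿ × ℂⁿ` be Zariski closed and a cylinder in the multiplicative
coordinate `yᵢ`, and suppose the torus part of the swapped set `W♯ = {z | z ∘ σᵢ ∈ W}` projects
dominantly to the additive factor. Then `W` meets the graph of `exp`: an exponential point `z♯` of
`W♯` (Aslanyan–Kirby–Mantova 2023 Thm. 1.5, tree theorem `aslanyanKirbyMantova2023_thm_1_5_holds`)
gives `w = z♯ ∘ σᵢ ∈ W` with `w_{y_j} = exp w_{x_j}` for all `j ≠ i`, and the cylinder allows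
`w_{y_i} := exp w_{x_i}`. [cite: AslanyanKirbyMantova2021, Thm. 1.5] -/
theorem inter_expGraph_nonempty_of_cylinder_of_swap {W : Set (Fin n ⊕ Fin n → ℂ)}
    (hW : IsZariskiClosed ℂ W) {i : Fin n} (hcyl : IsCoordCylinder W (Sum.inr i))
    (hdom : HasDominantAddProjection ℂ (swapSet i W ∩ torusLocus ℂ n)) :
    (W ∩ expGraph ℂ n).Nonempty := by
  obtain ⟨z, hzW, hzE⟩ := aslanyanKirbyMantova2023_thm_1_5_holds n (swapSet i W)
    (isZariskiClosed_swapSet i hW) hdom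
  have hwW : z ∘ xySwap i ∈ W := hzW
  refine ⟨Function.update (z ∘ xySwap i) (Sum.inr i)
    (ExponentialRing.exp ((z ∘ xySwap i) (Sum.inl i))), hcyl _ hwW _, ?_⟩
  rw [mem_expGraph_iff]
  intro j
  by_cases hj : j = i
  · subst hj
    rw [Function.update_self, Sum.update_inr_apply_inl]
  · rw [Sum.update_inr_apply_inl,
      Function.update_of_ne (show (Sum.inr j : Fin n ⊕ Fin n) ≠ Sum.inr i by simpa using hj)]
    simp only [Function.comp_apply, xySwap_inr_of_ne hj, xySwap_inl_of_ne hj]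
    exact (mem_expGraph_iff.1 hzE) j

/-! ## Dominance of the swapped set -/

variable (K) in
/-- **`π(V) + K·eᵢ` is Zariski dense in `Kⁿ`**: no nonzero polynomial in the additive coordinates
vanishes at all points `update (π z) i t`, `z ∈ V`, `t ∈ K` (equivalently: the projection of
`cl π(V)` forgetting the `i`-th coordinate is dominant onto `K^{n-1}`). [folklore] -/
def HasDominantAddProjectionOff (i : Fin n) (V : Set (Fin n ⊕ Fin n → K)) : Prop :=
  ∀ p : MvPolynomial (Fin n) K,
    (∀ z ∈ V, ∀ t : K, eval (Function.update (projAdd z) i t) p = 0) → p = 0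

/-- **Dominance of the swap.** Let `W` be irreducible closed, meeting the torus, with additively
free `V = W ∩ Gⁿ`, a cylinder in `yᵢ`, and with `π(V) + K·eᵢ` Zariski dense. Then `W♯ ∩ Gⁿ`
projects dominantly to the additive factor: a relation `p((x_j)_{j≠i}, yᵢ) = 0` on `W♯ ∩ Gⁿ` pulls
back to `p♮ ∈ K[X, Y]` vanishing on `V ∩ {xᵢ ≠ 0}`, so `p♮ · Xᵢ ∈ I(V) = I(W)` (prime, `Xᵢ ∉ I(W)`
by additive freeness), so `p♮ ∈ I(W)`; the cylinder then makes `p` vanish at every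
`update (π z) i t`. [folklore] -/
theorem hasDominantAddProjection_swapSet_of_cylinder {W : Set (Fin n ⊕ Fin n → K)}
    (hW : IsIrreducibleClosed K W) (hne : (W ∩ torusLocus K n).Nonempty)
    (hadd : IsAddFree K n (W ∩ torusLocus K n)) {i : Fin n}
    (hcyl : IsCoordCylinder W (Sum.inr i))
    (hoff : HasDominantAddProjectionOff K i (W ∩ torusLocus K n)) :
    HasDominantAddProjection K (swapSet i W ∩ torusLocus K n) := by
  intro p hp
  -- the pulled-back polynomial `p♮ = p(σᵢ ∘ inl)`
  set q : MvPolynomial (Fin n ⊕ Fin n) K := rename (fun j => xySwap i (Sum.inl j)) p with hq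
  have hq_eval : ∀ w : Fin n ⊕ Fin n → K,
      aeval w q = eval (fun j => w (xySwap i (Sum.inl j))) p := by
    intro w
    rw [hq, aeval_rename]
    rfl
  -- (1) `p♮` vanishes at the points of `W ∩ Gⁿ` with `xᵢ ≠ 0`
  have h1 : ∀ w ∈ W ∩ torusLocus K n, w (Sum.inl i) ≠ 0 → aeval w q = 0 := by
    intro w hw hwi
    rw [hq_eval]
    have hz : w ∘ xySwap i ∈ swapSet i W ∩ torusLocus K n := by
      refine ⟨(comp_xySwap_mem_swapSet_iff i W w).2 hw.1, fun j => ?_⟩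
      simp only [Function.comp_apply, xySwap_inr]
      split_ifs with hj
      · exact hwi
      · exact hw.2 j
    have hfun : (fun j => w (xySwap i (Sum.inl j))) = projAdd (w ∘ xySwap i) := by
      funext j
      rfl
    rw [hfun]
    exact hp _ hz
  -- (2) `p♮ · Xᵢ ∈ I(W ∩ Gⁿ) = I(W)`, hence `p♮ ∈ I(W)`
  have hIV := vanishingIdeal_inter_torusLocus_of_irred hW hne
  have h2 : q * X (Sum.inl i) ∈ vanishingIdeal K W := by
    rw [← hIV, mem_vanishingIdeal_iff]
    intro w hw
    rw [map_mul, aeval_X]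
    by_cases hwi : w (Sum.inl i) = 0
    · rw [hwi, mul_zero]
    · rw [h1 w hw hwi, zero_mul]
  have hXi : (X (Sum.inl i) : MvPolynomial (Fin n ⊕ Fin n) K) ∉ vanishingIdeal K W := fun h =>
    X_inl_notMem_vanishingIdeal_of_isAddFree hadd i
      (vanishingIdeal_anti_mono Set.inter_subset_left h)
  have hqW : q ∈ vanishingIdeal K W := (hW.2.mem_or_mem h2).resolve_right hXi
  -- (3) cylinder: `p` vanishes at every `update (π z) i t`
  refine hoff p fun z hz t => ?_
  have hu : Function.update z (Sum.inr i) t ∈ W := hcyl z hz.1 t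
  have h3 := (mem_vanishingIdeal_iff.1 hqW) _ hu
  rw [hq_eval] at h3
  have hfun : (fun j => Function.update z (Sum.inr i) t (xySwap i (Sum.inl j))) =
      Function.update (projAdd z) i t := by
    funext j
    rw [xySwap_inl]
    split_ifs with hj
    · subst hj
      rw [Function.update_self, Function.update_self]
    · rw [Sum.update_inr_apply_inl, Function.update_of_ne hj, projAdd_apply]
  rw [hfun] at h3
  exact h3

/-- **Density of `π(V) + K·eᵢ` from a cylinder direction of the base.** Suppose the indices are
`i`, `k`, `i'` only (so `n = 3` up to relabelling), the closure `Z(I(π V))` of the additive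
projection is invariant under changing the `k`-th coordinate (e.g. `e_k` is a period vector,
`mem_zeroLocus_vanishingIdeal_update_last_iff`), and the coordinate `x_{i'}` takes infinitely many
values on `V`. Then `π(V) + K·eᵢ` is Zariski dense in `Kⁿ`: a polynomial vanishing at all
`update (π z) i t` vanishes, for each fixed `t`, on `π(V)` hence on its closure, hence at all
`update (update x k s) i t` — a box with three infinite sides. [folklore] -/
theorem hasDominantAddProjectionOff_of_update_invariant [Infinite K] {V : Set (Fin n ⊕ Fin n → K)}
    {i k i' : Fin n} (hki : k ≠ i) (hi'i : i' ≠ i) (hi'k : i' ≠ k)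
    (h3 : ∀ j : Fin n, j = i ∨ j = k ∨ j = i')
    (hline : ∀ x ∈ zeroLocus K (vanishingIdeal K (projAdd '' V)), ∀ s : K,
      Function.update x k s ∈ zeroLocus K (vanishingIdeal K (projAdd '' V)))
    (hinf : ((fun z => z (Sum.inl i')) '' V).Infinite) :
    HasDominantAddProjectionOff K i V := by
  intro p hp
  -- (a) for each `t`, `p(Xᵢ ↦ t)` vanishes on `π(V)`, hence on its closure
  have hcl : ∀ x ∈ zeroLocus K (vanishingIdeal K (projAdd '' V)), ∀ t : K,
      eval (Function.update x i t) p = 0 := by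
    intro x hx t
    have hmem : bind₁ (Function.update X i (C t)) p ∈ vanishingIdeal K (projAdd '' V) := by
      rw [mem_vanishingIdeal_iff]
      rintro _ ⟨z, hz, rfl⟩
      change eval (projAdd z) _ = 0
      rw [eval_bind₁_update_X_C]
      exact hp z hz t
    have := (mem_zeroLocus_iff.1 hx) _ hmem
    change eval x _ = 0 at this
    rwa [eval_bind₁_update_X_C] at this
  -- (b) the line direction `k`
  have hb : ∀ x ∈ zeroLocus K (vanishingIdeal K (projAdd '' V)), ∀ s t : K,
      eval (Function.update (Function.update x k s) i t) p = 0 :=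
    fun x hx s t => hcl _ (hline x hx s) t
  -- (c) a box with infinite sides
  refine MvPolynomial.funext_set
    (fun j => if j = i' then (fun z => z (Sum.inl i')) '' V else Set.univ) ?_ ?_
  · intro j
    by_cases hj : j = i'
    · rw [if_pos hj]; exact hinf
    · rw [if_neg hj]; exact Set.infinite_univ
  · intro y hy
    rw [map_zero]
    have hyi' := (Set.mem_univ_pi.1 hy) i'
    rw [if_pos rfl] at hyi'
    obtain ⟨z, hz, hzy⟩ := hyi'
    have hxcl : projAdd z ∈ zeroLocus K (vanishingIdeal K (projAdd '' V)) := by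
      rw [mem_zeroLocus_iff]
      intro r hr
      exact (mem_vanishingIdeal_iff.1 hr) _ ⟨z, hz, rfl⟩
    have hy' : y = Function.update (Function.update (projAdd z) k (y k)) i (y i) := by
      funext j
      rcases h3 j with h | h | h
      · rw [h, Function.update_self]
      · rw [h, Function.update_of_ne hki, Function.update_self]
      · rw [h, Function.update_of_ne hi'i, Function.update_of_ne hi'k, projAdd_apply]
        exact hzy.symm
    rw [hy']
    exact hb _ hxcl _ _

/-- **Cylinders in `yᵢ` with `π(V) + ℂ·eᵢ` dense meet the graph of `exp`** (any `n`): the swap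
trick (`inter_expGraph_nonempty_of_cylinder_of_swap`) with the dominance supplied by
`hasDominantAddProjection_swapSet_of_cylinder`. [cite: AslanyanKirbyMantova2021, Thm. 1.5] -/
theorem inter_expGraph_nonempty_of_cylinder_of_off {W : Set (Fin n ⊕ Fin n → ℂ)}
    (hW : IsIrreducibleClosed ℂ W) (hne : (W ∩ torusLocus ℂ n).Nonempty)
    (hadd : IsAddFree ℂ n (W ∩ torusLocus ℂ n)) {i : Fin n} (hcyl : IsCoordCylinder W (Sum.inr i))
    (hoff : HasDominantAddProjectionOff ℂ i (W ∩ torusLocus ℂ n)) :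
    (W ∩ expGraph ℂ n).Nonempty :=
  inter_expGraph_nonempty_of_cylinder_of_swap hW.1 hcyl
    (hasDominantAddProjection_swapSet_of_cylinder hW hne hadd hcyl hoff)

/-! ## The normalised periodic sub-cell of `EC(3,2)`: side cylinders are settled -/

/-- In `Fin 3`, next to `i ≠ last` and `last` there is exactly one further index. [folklore] -/
theorem fin_three_third (i : Fin (2 + 1)) (hi : i ≠ Fin.last 2) :
    ∃ i' : Fin (2 + 1), i' ≠ i ∧ i' ≠ Fin.last 2 ∧ ∀ j : Fin (2 + 1), j = i ∨ j = Fin.last 2 ∨ j = i' := by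
  revert i
  decide

/-- **Side cylinders of the periodic sub-cell of `EC(3,2)` meet the graph of `exp`.** Let
`W ⊆ ℂ³ × ℂ³` be irreducible Zariski closed, meeting `G³`, with additively free `V = W ∩ G³`, such
that `e_last` is a period vector of `π(V)` (the normalised periodic sub-cell: `cl π(V) = C × ℂ`),
and suppose `W` is a cylinder in a multiplicative coordinate `yᵢ` with `i ≠ last`. Then `W` meets
the graph of `exp`. No rotundity, multiplicative freeness or dimension hypothesis is used. Proof:
swap `xᵢ ↔ yᵢ`; the swapped set projects dominantly because `cl π(V)` is a cylinder over the last
coordinate and the third additive coordinate is non-constant; conclude by Aslanyan–Kirby–Mantova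
Thm. 1.5. [cite: AslanyanKirbyMantova2021, Thm. 1.5] -/
theorem inter_expGraph_nonempty_of_isPeriodVec_of_cylinder
    {W : Set (Fin (2 + 1) ⊕ Fin (2 + 1) → ℂ)}
    (hW : IsIrreducibleClosed ℂ W) (hne : (W ∩ torusLocus ℂ (2 + 1)).Nonempty)
    (hadd : IsAddFree ℂ (2 + 1) (W ∩ torusLocus ℂ (2 + 1)))
    (hper : IsPeriodVec ℂ (projAdd '' (W ∩ torusLocus ℂ (2 + 1))) (Pi.single (Fin.last 2) 1))
    {i : Fin (2 + 1)} (hi : i ≠ Fin.last 2) (hcyl : IsCoordCylinder W (Sum.inr i)) :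
    (W ∩ expGraph ℂ (2 + 1)).Nonempty := by
  obtain ⟨i', hi'i, hi'k, h3⟩ := fin_three_third i hi
  refine inter_expGraph_nonempty_of_cylinder_of_off hW hne hadd hcyl ?_
  refine hasDominantAddProjectionOff_of_update_invariant (Ne.symm hi) hi'i hi'k h3 ?_ ?_
  · intro x hx s
    exact (mem_zeroLocus_vanishingIdeal_update_last_iff hper x s).2 hx
  · exact infinite_inl_image_of_isAddFree hW hne hadd i'

/-! ## The refined split of `ECCell 3 2` -/

/-- **Normalised periodic sub-cell WITHOUT side cylinders**: the binders of `ECCellPeriodicStd d`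
plus "`W` is a cylinder in no multiplicative coordinate `yᵢ`, `i ≠ last`".  OPEN for `d = 2`;
never asserted. [cite: MantovaMasser2023, §1 Further remarks] -/
def ECCellPeriodicStdNC (d : ℕ) : Prop :=
  ∀ (W : Set (Fin (d + 1) ⊕ Fin (d + 1) → ℂ)), IsIrreducibleClosed ℂ W →
    (W ∩ torusLocus ℂ (d + 1)).Nonempty → IsRotund ℂ (d + 1) (W ∩ torusLocus ℂ (d + 1)) →
    IsAddFree ℂ (d + 1) (W ∩ torusLocus ℂ (d + 1)) → IsMulFree ℂ (d + 1) (W ∩ torusLocus ℂ (d + 1)) →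
    zariskiDim ℂ W = (d + 1 : ℕ) → addProjDim ℂ (d + 1) W = d →
    IsPeriodVec ℂ (projAdd '' (W ∩ torusLocus ℂ (d + 1))) (Pi.single (Fin.last d) 1) →
    (∀ i : Fin (d + 1), i ≠ Fin.last d → ¬ IsCoordCylinder W (Sum.inr i)) →
    (W ∩ expGraph ℂ (d + 1)).Nonempty

/-- **Fibred periodic piece WITHOUT side cylinders**: the binders of `ECCellPeriodicStdFib d` plus
"`W` is a cylinder in no `yᵢ`, `i ≠ last`".  OPEN for `d = 2` (contains Mantova–Masser's density
question for unprojected exponential points over curve bases); never asserted.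
[cite: MantovaMasser2023, §1 Further remarks] -/
def ECCellPeriodicStdFibNC (d : ℕ) : Prop :=
  ∀ (W : Set (Fin (d + 1) ⊕ Fin (d + 1) → ℂ)), IsIrreducibleClosed ℂ W →
    (W ∩ torusLocus ℂ (d + 1)).Nonempty → IsRotund ℂ (d + 1) (W ∩ torusLocus ℂ (d + 1)) →
    IsAddFree ℂ (d + 1) (W ∩ torusLocus ℂ (d + 1)) → IsMulFree ℂ (d + 1) (W ∩ torusLocus ℂ (d + 1)) →
    zariskiDim ℂ W = (d + 1 : ℕ) → addProjDim ℂ (d + 1) W = d →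
    IsPeriodVec ℂ (projAdd '' (W ∩ torusLocus ℂ (d + 1))) (Pi.single (Fin.last d) 1) →
    zariskiDim ℂ (matrixAct (dropLastMat d) '' (W ∩ torusLocus ℂ (d + 1))) = d →
    (∀ i : Fin (d + 1), i ≠ Fin.last d → ¬ IsCoordCylinder W (Sum.inr i)) →
    (W ∩ expGraph ℂ (d + 1)).Nonempty

/-- **Co-dominant periodic piece WITHOUT side cylinders**: the binders of `ECCellPeriodicStdDom d`
plus "`W` is a cylinder in no `yᵢ`, `i ≠ last`".  OPEN for `d = 2`; never asserted.
[cite: MantovaMasser2023, §1 Further remarks] -/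
def ECCellPeriodicStdDomNC (d : ℕ) : Prop :=
  ∀ (W : Set (Fin (d + 1) ⊕ Fin (d + 1) → ℂ)), IsIrreducibleClosed ℂ W →
    (W ∩ torusLocus ℂ (d + 1)).Nonempty → IsRotund ℂ (d + 1) (W ∩ torusLocus ℂ (d + 1)) →
    IsAddFree ℂ (d + 1) (W ∩ torusLocus ℂ (d + 1)) → IsMulFree ℂ (d + 1) (W ∩ torusLocus ℂ (d + 1)) →
    zariskiDim ℂ W = (d + 1 : ℕ) → addProjDim ℂ (d + 1) W = d →
    IsPeriodVec ℂ (projAdd '' (W ∩ torusLocus ℂ (d + 1))) (Pi.single (Fin.last d) 1) →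
    zariskiDim ℂ (matrixAct (dropLastMat d) '' (W ∩ torusLocus ℂ (d + 1))) = (d + 1 : ℕ) →
    (∀ i : Fin (d + 1), i ≠ Fin.last d → ¬ IsCoordCylinder W (Sum.inr i)) →
    (W ∩ expGraph ℂ (d + 1)).Nonempty

/-- **In the normalised periodic sub-cell of `EC(3,2)` it suffices to treat non-cylinders**:
`ECCellPeriodicStd 2 ↔ ECCellPeriodicStdNC 2`. [cite: MantovaMasser2023, §1 Further remarks] -/
theorem ecCellPeriodicStd_two_iff_nc : ECCellPeriodicStd 2 ↔ ECCellPeriodicStdNC 2 := by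
  constructor
  · intro h W hW hne hrot hadd hmul hdim hapd hper _
    exact h W hW hne hrot hadd hmul hdim hapd hper
  · intro h W hW hne hrot hadd hmul hdim hapd hper
    by_cases hc : ∃ i : Fin (2 + 1), i ≠ Fin.last 2 ∧ IsCoordCylinder W (Sum.inr i)
    · obtain ⟨i, hi, hcyl⟩ := hc
      exact inter_expGraph_nonempty_of_isPeriodVec_of_cylinder hW hne hadd hper hi hcyl
    · push Not at hc
      exact h W hW hne hrot hadd hmul hdim hapd hper hc

/-- Fibred piece: `ECCellPeriodicStdFib 2 ↔ ECCellPeriodicStdFibNC 2`.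
[cite: MantovaMasser2023, §1 Further remarks] -/
theorem ecCellPeriodicStdFib_two_iff_nc : ECCellPeriodicStdFib 2 ↔ ECCellPeriodicStdFibNC 2 := by
  constructor
  · intro h W hW hne hrot hadd hmul hdim hapd hper hfib _
    exact h W hW hne hrot hadd hmul hdim hapd hper hfib
  · intro h W hW hne hrot hadd hmul hdim hapd hper hfib
    by_cases hc : ∃ i : Fin (2 + 1), i ≠ Fin.last 2 ∧ IsCoordCylinder W (Sum.inr i)
    · obtain ⟨i, hi, hcyl⟩ := hc
      exact inter_expGraph_nonempty_of_isPeriodVec_of_cylinder hW hne hadd hper hi hcyl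
    · push Not at hc
      exact h W hW hne hrot hadd hmul hdim hapd hper hfib hc

/-- Co-dominant piece: `ECCellPeriodicStdDom 2 ↔ ECCellPeriodicStdDomNC 2`.
[cite: MantovaMasser2023, §1 Further remarks] -/
theorem ecCellPeriodicStdDom_two_iff_nc : ECCellPeriodicStdDom 2 ↔ ECCellPeriodicStdDomNC 2 := by
  constructor
  · intro h W hW hne hrot hadd hmul hdim hapd hper hdom _
    exact h W hW hne hrot hadd hmul hdim hapd hper hdom
  · intro h W hW hne hrot hadd hmul hdim hapd hper hdom
    by_cases hc : ∃ i : Fin (2 + 1), i ≠ Fin.last 2 ∧ IsCoordCylinder W (Sum.inr i)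
    · obtain ⟨i, hi, hcyl⟩ := hc
      exact inter_expGraph_nonempty_of_isPeriodVec_of_cylinder hW hne hadd hper hi hcyl
    · push Not at hc
      exact h W hW hne hrot hadd hmul hdim hapd hper hdom hc

/-- **The refined split of the next open cell**:
`ECCell 3 2 ↔ ECCellAperiodic 2 ∧ ECCellPeriodicStdFibNC 2 ∧ ECCellPeriodicStdDomNC 2` — the
aperiodic piece, and the two periodic pieces restricted to varieties that are cylinders in no
multiplicative coordinate over the curve factor.  All three pieces OPEN.
[cite: MantovaMasser2023, §1 Further remarks] -/
theorem ecCell_three_two_iff_three_nc : ECCell 3 2 ↔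
    ECCellAperiodic 2 ∧ ECCellPeriodicStdFibNC 2 ∧ ECCellPeriodicStdDomNC 2 := by
  rw [ecCell_three_two_iff_three, ecCellPeriodicStdFib_two_iff_nc, ecCellPeriodicStdDom_two_iff_nc]

/-- Coarser form: `ECCell 3 2 ↔ ECCellAperiodic 2 ∧ ECCellPeriodicStdNC 2`.
[cite: MantovaMasser2023, §1 Further remarks] -/
theorem ecCell_three_two_iff_aperiodic_and_nc : ECCell 3 2 ↔
    ECCellAperiodic 2 ∧ ECCellPeriodicStdNC 2 := by
  rw [ecCell_three_two_iff_aperiodic_and_std, ecCellPeriodicStd_two_iff_nc]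

end Literature.ModelTheory.Zilber
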